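import Mathlib
import Summits.ValiantsHypothesis.ValiantsHypothesis.Theorems.NewtonUnitEquationsNewtonTauWeakCornerDefs

/-!
# `NewtonTauWeak` (stmt-ValiantsHypothesis-5904), `K = 3` coincidence rung, "lines" route:
# univariate factors along a direction, word expansions, truncation

Second support file (siege k11) for the sub-stub `fixedKCoincidence_t2_K3` of `stub_binomialNewtonTauCommon`
(KPTT arXiv:1308.2286 Conj. 1 at `t = 2`, three products).  In the Laurent algebra `ℂ[ℤ²]` a separated
product is `Π_e Q_e(X^{E_e})` for univariate `Q_e ∈ ℂ[X]` and directions `E_e ∈ ℤ²`; here: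

* `emb(E, Q) = aeval (X^E) Q`, its monomial expansion, coefficients and supports (`emb_eq_sum`,
  `mem_support_emb`), weights of its support (`heavy_emb`, `heavy_emb_of_coeff_eq_zero`) and its strict
  minimum at the corner (`smin_emb_zero`);
* the WORD EXPANSION of a separated product over the word box of the corner model
  (`prod_emb_eq_sum`, `coeff_prod_emb`: the coefficient of `X^z` is the fibre sum of `sepCoeff` over the
  words `n` with `push E n = z` — objects of `Theorems/NewtonUnitEquationsNewtonTauWeakCornerDefs.lean`);
* truncation `tr(T, P)` of a polynomial below degree `T + 1`, truncated inverses of univariate units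
  (`exists_trunc_inv`), and the ORDER TRANSFER lemma `order_transfer` (a polynomial congruent to `Δ·R`
  modulo `X^{T+1}` with `R(0) = 1` has the trailing degree of `Δ`).

Definition-free (notations only). Everything is [folklore].
-/

set_option linter.dupNamespace false

noncomputable section

open scoped BigOperators Polynomial
open Summit.ValiantsHypothesis.ValiantsHypothesis.Theorems.NewtonTauWeakCorner
  (wt push sepCoeff box IsOrder wt_add wt_zero wt_zsmul wt_push)

namespace Summit.ValiantsHypothesis.ValiantsHypothesis.Theorems.NewtonTauWeakK3Lines

local notation3 "Lau" => AddMonoidAlgebra ℂ (Fin 2 → ℤ)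

local notation3 "SMin(" w ", " a ", " x ")" =>
  (AddMonoidAlgebra.coeff a x ≠ 0 ∧ ∀ y ∈ (AddMonoidAlgebra.coeff a).support, y ≠ x → wt w x < wt w y)

local notation3 "Heavy(" w ", " Ω ", " a ")" => (∀ y ∈ (AddMonoidAlgebra.coeff a).support, Ω ≤ wt w y)

/-- `emb(E, Q) = Q(X^E)`: the univariate polynomial `Q` placed along the direction `E ∈ ℤ²`. -/
local notation3 "emb(" E ", " Q ")" =>
  (Polynomial.aeval (R := ℂ) (AddMonoidAlgebra.single (E : Fin 2 → ℤ) (1 : ℂ) : Lau) Q)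

/-- `tr(T, P)`: the truncation of `P` below degree `T + 1`. -/
local notation3 "tr(" T ", " P ")" => (PowerSeries.trunc (T + 1) (↑(P : ℂ[X]) : PowerSeries ℂ))

-- BEGIN BODY
/-! ## The univariate embedding along a direction -/

/-- `emb` of a power of the variable is the monomial at the corresponding multiple of the direction.
[folklore] -/
theorem emb_X_pow (E : Fin 2 → ℤ) (k : ℕ) :
    emb(E, (Polynomial.X : ℂ[X]) ^ k) = AddMonoidAlgebra.single ((k : ℤ) • E) 1 := by
  rw [Polynomial.aeval_X_pow, AddMonoidAlgebra.single_pow, one_pow, natCast_zsmul]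

/-- `emb` of a constant. [folklore] -/
theorem emb_C (E : Fin 2 → ℤ) (c : ℂ) : emb(E, Polynomial.C c) = AddMonoidAlgebra.single 0 c := by
  rw [Polynomial.aeval_C]
  simp [AddMonoidAlgebra.coe_algebraMap]

/-- Monomial expansion of `emb(E, Q)` with any degree bound `D`. [folklore] -/
theorem emb_eq_sum (E : Fin 2 → ℤ) (Q : ℂ[X]) {D : ℕ} (hD : Q.natDegree ≤ D) :
    emb(E, Q) = ∑ k ∈ Finset.range (D + 1), AddMonoidAlgebra.single ((k : ℤ) • E) (Q.coeff k) := by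
  rw [Polynomial.aeval_eq_sum_range' (Nat.lt_succ_of_le hD)]
  refine Finset.sum_congr rfl fun k _ => ?_
  rw [AddMonoidAlgebra.single_pow, one_pow, AddMonoidAlgebra.smul_single, smul_eq_mul, mul_one,
    natCast_zsmul]

/-- Distinct multiples of a nonzero direction are distinct. [folklore] -/
theorem zsmul_left_injective_of_ne_zero {E : Fin 2 → ℤ} (hE : E ≠ 0) :
    Function.Injective fun k : ℤ => k • E := by
  intro k k' h
  simp only at h
  have h0 : (k - k') • E = 0 := by rw [sub_smul, h, sub_self]
  rcases smul_eq_zero.mp h0 with h1 | h1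
  · linarith
  · exact absurd h1 hE

/-- Coefficients of `emb(E, Q)` on the multiples of `E`. [folklore] -/
theorem coeff_emb {E : Fin 2 → ℤ} (hE : E ≠ 0) (Q : ℂ[X]) (k : ℕ) :
    (emb(E, Q)).coeff ((k : ℤ) • E) = Q.coeff k := by
  classical
  rw [emb_eq_sum E Q le_rfl, AddMonoidAlgebra.coeff_sum, Finsupp.finsetSum_apply]
  simp only [AddMonoidAlgebra.coeff_single]
  rw [Finset.sum_eq_single k]
  · rw [Finsupp.single_eq_same]
  · intro j _ hjk
    rw [Finsupp.single_eq_of_ne]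
    intro h
    exact hjk (by exact_mod_cast (zsmul_left_injective_of_ne_zero hE h).symm)
  · intro hk
    rw [Finset.mem_range, not_lt] at hk
    rw [Polynomial.coeff_eq_zero_of_natDegree_lt (Nat.lt_of_succ_le hk), Finsupp.single_zero,
      Finsupp.zero_apply]

/-- Support points of `emb(E, Q)` are multiples `k • E` with `Q.coeff k ≠ 0`. [folklore] -/
theorem mem_support_emb (E : Fin 2 → ℤ) (Q : ℂ[X]) {z : Fin 2 → ℤ}
    (hz : z ∈ (emb(E, Q)).coeff.support) : ∃ k : ℕ, Q.coeff k ≠ 0 ∧ z = (k : ℤ) • E := by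
  classical
  rw [emb_eq_sum E Q le_rfl, AddMonoidAlgebra.coeff_sum] at hz
  obtain ⟨k, -, hk⟩ := Finset.mem_biUnion.mp (Finsupp.support_finsetSum hz)
  rw [AddMonoidAlgebra.coeff_single] at hk
  by_cases hq : Q.coeff k = 0
  · rw [hq, Finsupp.single_zero] at hk; simp at hk
  · have := Finsupp.support_single_subset hk
    rw [Finset.mem_singleton] at this
    exact ⟨k, hq, this⟩

/-- Along a direction of nonnegative weight `emb(E, Q)` is `0`-heavy. [folklore] -/
theorem heavy_emb {w : Fin 2 → ℝ} {E : Fin 2 → ℤ} (hw : 0 ≤ wt w E) (Q : ℂ[X]) :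
    Heavy(w, 0, emb(E, Q)) := by
  intro y hy
  obtain ⟨k, -, rfl⟩ := mem_support_emb E Q hy
  rw [wt_zsmul]
  exact mul_nonneg (by exact_mod_cast Nat.zero_le k) hw

/-- If the coefficients of `Q` vanish up to degree `T`, then `emb(E, Q)` weighs at least `(T+1)·wt E`.
[folklore] -/
theorem heavy_emb_of_coeff_eq_zero {w : Fin 2 → ℝ} {E : Fin 2 → ℤ} (hw : 0 ≤ wt w E) (Q : ℂ[X]) {T : ℕ}
    (hQ : ∀ k, k ≤ T → Q.coeff k = 0) : Heavy(w, (T + 1 : ℝ) * wt w E, emb(E, Q)) := by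
  intro y hy
  obtain ⟨k, hk, rfl⟩ := mem_support_emb E Q hy
  have hkT : T + 1 ≤ k := by
    by_contra hlt
    exact hk (hQ k (by omega))
  rw [wt_zsmul]
  exact mul_le_mul_of_nonneg_right (by exact_mod_cast hkT) hw

/-- Along a direction of positive weight, a univariate polynomial with nonzero constant term has its strict
minimum at the corner, with that constant as coefficient. [folklore] -/
theorem smin_emb_zero {w : Fin 2 → ℝ} {E : Fin 2 → ℤ} (hw : 0 < wt w E) (Q : ℂ[X]) (hQ : Q.coeff 0 ≠ 0) :
    SMin(w, emb(E, Q), 0) ∧ (emb(E, Q)).coeff 0 = Q.coeff 0 := by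
  have hE : E ≠ 0 := by rintro rfl; rw [wt_zero] at hw; exact lt_irrefl _ hw
  have h0 : (emb(E, Q)).coeff 0 = Q.coeff 0 := by
    have := coeff_emb hE Q 0
    rwa [Nat.cast_zero, zero_smul] at this
  refine ⟨⟨by rw [h0]; exact hQ, fun y hy hy0 => ?_⟩, h0⟩
  obtain ⟨k, -, rfl⟩ := mem_support_emb E Q hy
  have hk : k ≠ 0 := by rintro rfl; exact hy0 (by simp)
  rw [wt_zero, wt_zsmul]
  exact mul_pos (by exact_mod_cast Nat.pos_of_ne_zero hk) hw

/-! ## Word expansion of a separated product -/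

/-- **Word expansion.** A separated product `Π_i Q_i(X^{E_i})` with all degrees `≤ D` is the sum over the
word box `{0..D}^s` of the monomials `X^{push E n}` with the separated coefficients `sepCoeff Q n`.
[folklore] -/
theorem prod_emb_eq_sum {s D : ℕ} (E : Fin s → Fin 2 → ℤ) (Q : Fin s → ℂ[X])
    (hD : ∀ i, (Q i).natDegree ≤ D) :
    ∏ i, emb(E i, Q i) = ∑ n ∈ box s D, AddMonoidAlgebra.single (push E n) (sepCoeff Q n) := by
  classical
  have : ∀ i, emb(E i, Q i) =
      ∑ k ∈ Finset.range (D + 1), AddMonoidAlgebra.single ((k : ℤ) • E i) ((Q i).coeff k) :=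
    fun i => emb_eq_sum (E i) (Q i) (hD i)
  simp_rw [this]
  rw [Finset.prod_univ_sum]
  refine Finset.sum_congr rfl fun n _ => ?_
  rw [AddMonoidAlgebra.prod_single]
  rfl

/-- **Coefficients of a separated product are fibre sums** of the separated coefficients over the words
pushing to the given point. [folklore] -/
theorem coeff_prod_emb {s D : ℕ} (E : Fin s → Fin 2 → ℤ) (Q : Fin s → ℂ[X])
    (hD : ∀ i, (Q i).natDegree ≤ D) (z : Fin 2 → ℤ) :
    (∏ i, emb(E i, Q i)).coeff z = ∑ n ∈ (box s D).filter (fun n => push E n = z), sepCoeff Q n := by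
  classical
  rw [prod_emb_eq_sum E Q hD, AddMonoidAlgebra.coeff_sum, Finsupp.finsetSum_apply, Finset.sum_filter]
  refine Finset.sum_congr rfl fun n _ => ?_
  rw [AddMonoidAlgebra.coeff_single, Finsupp.single_apply]

/-- A separated product along directions of nonnegative weight is `0`-heavy. [folklore] -/
theorem heavy_prod_emb {w : Fin 2 → ℝ} {s : ℕ} (E : Fin s → Fin 2 → ℤ) (hw : ∀ i, 0 ≤ wt w (E i))
    (Q : Fin s → ℂ[X]) : Heavy(w, 0, ∏ i, emb(E i, Q i)) := by
  classical
  intro y hy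
  -- induction-free: use the word expansion with a common degree bound
  obtain ⟨D, hD⟩ : ∃ D, ∀ i, (Q i).natDegree ≤ D :=
    ⟨Finset.univ.sup fun i => (Q i).natDegree,
      fun i => Finset.le_sup (f := fun i => (Q i).natDegree) (Finset.mem_univ i)⟩
  rw [prod_emb_eq_sum E Q hD, AddMonoidAlgebra.coeff_sum] at hy
  obtain ⟨n, -, hn⟩ := Finset.mem_biUnion.mp (Finsupp.support_finsetSum hy)
  rw [AddMonoidAlgebra.coeff_single] at hn
  have := Finsupp.support_single_subset hn
  rw [Finset.mem_singleton] at this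
  rw [this, wt_push]
  exact Finset.sum_nonneg fun i _ => mul_nonneg (by exact_mod_cast Nat.zero_le _) (hw i)

/-- **A separated product of univariate units has its strict minimum at the corner, with coefficient `1`.**
[folklore] -/
theorem smin_prod_emb_zero {w : Fin 2 → ℝ} {s : ℕ} (E : Fin s → Fin 2 → ℤ) (hw : ∀ i, 0 < wt w (E i))
    (Q : Fin s → ℂ[X]) (hQ : ∀ i, (Q i).coeff 0 = 1) :
    SMin(w, ∏ i, emb(E i, Q i), 0) ∧ (∏ i, emb(E i, Q i)).coeff 0 = 1 := by
  classical
  obtain ⟨D, hD⟩ : ∃ D, ∀ i, (Q i).natDegree ≤ D :=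
    ⟨Finset.univ.sup fun i => (Q i).natDegree,
      fun i => Finset.le_sup (f := fun i => (Q i).natDegree) (Finset.mem_univ i)⟩
  -- coefficient at the corner: only the empty word pushes to `0`
  have hwt : ∀ n ∈ box s D, n ≠ 0 → 0 < wt w (push E n) := by
    intro n _ hn
    obtain ⟨i, hi⟩ : ∃ i, n i ≠ 0 := by
      by_contra h
      push Not at h
      exact hn (funext h)
    rw [wt_push]
    have hpos : (0 : ℝ) < (n i : ℝ) := by exact_mod_cast Nat.pos_of_ne_zero hi
    refine lt_of_lt_of_le (mul_pos hpos (hw i)) ?_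
    exact Finset.single_le_sum (f := fun e => (n e : ℝ) * wt w (E e))
      (fun e _ => mul_nonneg (by exact_mod_cast Nat.zero_le _) (hw e).le) (Finset.mem_univ i)
  have h0 : (∏ i, emb(E i, Q i)).coeff 0 = 1 := by
    rw [coeff_prod_emb E Q hD, Finset.sum_eq_single (0 : Fin s → ℕ)]
    · simp [sepCoeff, hQ]
    · intro n hn hn0
      exfalso
      obtain ⟨hnb, hpush⟩ := Finset.mem_filter.mp hn
      have := hwt n hnb hn0
      rw [hpush, wt_zero] at this
      exact lt_irrefl _ this
    · intro h
      exfalso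
      exact h (Finset.mem_filter.mpr ⟨by simp [box], by simp [push]⟩)
  refine ⟨⟨by rw [h0]; exact one_ne_zero, fun y hy hy0 => ?_⟩, h0⟩
  rw [prod_emb_eq_sum E Q hD, AddMonoidAlgebra.coeff_sum] at hy
  obtain ⟨n, hnb, hn⟩ := Finset.mem_biUnion.mp (Finsupp.support_finsetSum hy)
  rw [AddMonoidAlgebra.coeff_single] at hn
  have := Finsupp.support_single_subset hn
  rw [Finset.mem_singleton] at this
  rw [this, wt_zero]
  refine hwt n hnb ?_
  rintro rfl
  exact hy0 (by rw [this]; simp [push])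

/-! ## Truncation, truncated inverses, order transfer -/

/-- Coefficients of the truncation. [folklore] -/
theorem coeff_tr (T : ℕ) (P : ℂ[X]) (k : ℕ) : (tr(T, P)).coeff k = if k ≤ T then P.coeff k else 0 := by
  rw [PowerSeries.coeff_trunc, Polynomial.coeff_coe]
  by_cases hk : k ≤ T
  · rw [if_pos (Nat.lt_succ_of_le hk), if_pos hk]
  · rw [if_neg (fun h => hk (Nat.le_of_lt_succ h)), if_neg hk]

/-- The truncation has degree at most `T`. [folklore] -/
theorem natDegree_tr_le (T : ℕ) (P : ℂ[X]) : (tr(T, P)).natDegree ≤ T :=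
  Nat.le_of_lt_succ (PowerSeries.natDegree_trunc_lt _ T)

/-- **Truncated inverse of a univariate unit**: for `Q(0) = 1` and every `T` there is `R` with `R(0) = 1`,
`deg R ≤ T` and `Q·R ≡ 1 (mod X^{T+1})`. [folklore] -/
theorem exists_trunc_inv (Q : ℂ[X]) (hQ : Q.coeff 0 = 1) (T : ℕ) :
    ∃ R : ℂ[X], R.coeff 0 = 1 ∧ R.natDegree ≤ T ∧ ∀ k, 1 ≤ k → k ≤ T → (Q * R).coeff k = 0 := by
  set φ : PowerSeries ℂ := (Q : PowerSeries ℂ) with hφ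
  have hφ0 : PowerSeries.constantCoeff φ ≠ 0 := by
    rw [hφ, ← PowerSeries.coeff_zero_eq_constantCoeff_apply, Polynomial.coeff_coe, hQ]
    exact one_ne_zero
  have hinv : φ * φ⁻¹ = 1 := PowerSeries.mul_inv_cancel φ hφ0
  refine ⟨PowerSeries.trunc (T + 1) φ⁻¹, ?_, Nat.le_of_lt_succ (PowerSeries.natDegree_trunc_lt _ T), ?_⟩
  -- the product agrees with `φ φ⁻¹ = 1` in all degrees `≤ T`
  · have h := congrArg (PowerSeries.coeff 0) hinv
    rw [PowerSeries.coeff_mul, PowerSeries.coeff_one, if_pos rfl,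
      Finset.Nat.antidiagonal_zero, Finset.sum_singleton] at h
    simp only at h
    rw [hφ, Polynomial.coeff_coe, hQ, one_mul] at h
    rw [PowerSeries.coeff_trunc, if_pos (Nat.succ_pos T)]
    exact h
  · intro k hk1 hkT
    have h := congrArg (PowerSeries.coeff k) hinv
    rw [PowerSeries.coeff_mul, PowerSeries.coeff_one, if_neg (by omega)] at h
    rw [Polynomial.coeff_mul, ← h]
    refine Finset.sum_congr rfl fun ij hij => ?_
    have hj : ij.2 ≤ T := (Finset.HasAntidiagonal.antidiagonal.snd_le hij).trans hkT
    rw [PowerSeries.coeff_trunc, if_pos (Nat.lt_succ_of_le hj), hφ, Polynomial.coeff_coe]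

/-- **Order transfer.** If `A` (of degree `≤ T`) agrees with `Δ·R` in all degrees `≤ T`, where `R(0) = 1`
and `deg Δ ≤ T`, then `A = 0 ↔ Δ = 0`, and for `Δ ≠ 0` the polynomial `A` vanishes below the trailing
degree of `Δ` and does not vanish at it. [folklore] -/
theorem order_transfer {A Δ R : ℂ[X]} {T : ℕ} (hR : R.coeff 0 = 1) (hA : A.natDegree ≤ T)
    (hΔ : Δ.natDegree ≤ T) (hcong : ∀ k, k ≤ T → A.coeff k = (Δ * R).coeff k) :
    (A = 0 ↔ Δ = 0) ∧ (Δ ≠ 0 → A.coeff Δ.natTrailingDegree ≠ 0 ∧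
      ∀ j, j < Δ.natTrailingDegree → A.coeff j = 0) := by
  have hR0 : R ≠ 0 := by rintro rfl; simp at hR
  have hRtd : R.natTrailingDegree = 0 :=
    le_antisymm (Polynomial.natTrailingDegree_le_of_ne_zero (by rw [hR]; exact one_ne_zero)) (Nat.zero_le _)
  -- the nonzero case
  have hne : Δ ≠ 0 → A.coeff Δ.natTrailingDegree ≠ 0 ∧ ∀ j, j < Δ.natTrailingDegree → A.coeff j = 0 := by
    intro hΔ0
    have hoT : Δ.natTrailingDegree ≤ T := (Polynomial.natTrailingDegree_le_natDegree Δ).trans hΔ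
    have htd : (Δ * R).natTrailingDegree = Δ.natTrailingDegree := by
      rw [Polynomial.natTrailingDegree_mul hΔ0 hR0, hRtd, add_zero]
    constructor
    · rw [hcong _ hoT, ← htd]
      change (Δ * R).trailingCoeff ≠ 0
      rw [Polynomial.trailingCoeff_mul]
      exact mul_ne_zero (Polynomial.trailingCoeff_nonzero_iff_nonzero.mpr hΔ0)
        (Polynomial.trailingCoeff_nonzero_iff_nonzero.mpr hR0)
    · intro j hj
      rw [hcong j (by omega)]
      exact Polynomial.coeff_eq_zero_of_lt_natTrailingDegree (by rw [htd]; exact hj)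
  refine ⟨⟨fun hA0 => ?_, fun hΔ0 => ?_⟩, hne⟩
  · by_contra hΔ0
    exact (hne hΔ0).1 (by rw [hA0, Polynomial.coeff_zero])
  · ext k
    rw [Polynomial.coeff_zero]
    by_cases hk : k ≤ T
    · rw [hcong k hk, hΔ0, zero_mul, Polynomial.coeff_zero]
    · exact Polynomial.coeff_eq_zero_of_natDegree_lt (by omega)

/-- Uniqueness of the corner order of a univariate factor. [folklore] -/
theorem isOrder_eq_of_coeff {P : ℂ[X]} {k o : ℕ} (hk : IsOrder P k) (ho1 : 1 ≤ o) (hPo : P.coeff o ≠ 0)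
    (hvan : ∀ j, 1 ≤ j → j < o → P.coeff j = 0) : k = o := by
  obtain ⟨hk1, hPk, hkvan⟩ := hk
  by_contra hne
  rcases Nat.lt_or_gt_of_ne hne with hlt | hgt
  · exact hPk (hvan k hk1 hlt)
  · exact hPo (hkvan o ho1 hgt)


/-- Registered form (`k11_coeff_prod_emb`, notation-free) of `coeff_prod_emb`. [folklore] -/
theorem k11_coeff_prod_emb (s D : ℕ) (E : Fin s → Fin 2 → ℤ) (Q : Fin s → Polynomial ℂ) (hD : ∀ i, (Q i).natDegree ≤ D) (z : Fin 2 → ℤ) : (∏ i, Polynomial.aeval (R := ℂ) (AddMonoidAlgebra.single (E i) (1 : ℂ) : AddMonoidAlgebra ℂ (Fin 2 → ℤ)) (Q i)).coeff z = ∑ n ∈ (box s D).filter (fun n => push E n = z), sepCoeff Q n :=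
  coeff_prod_emb E Q hD z
-- END BODY
end Summit.ValiantsHypothesis.ValiantsHypothesis.Theorems.NewtonTauWeakK3Lines

end
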